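import Literature.NumberTheory.Sieve.SelbergSieveOneDim
import Literature.NumberTheory.Sieve.FGKMT2018Prop91Assembly
import HarnessLib

/-!
# Maynard's Proposition 9.4: the one-dimensional diagonal sum

Source: J. Maynard, *Dense clusters of primes in subsets*, Compositio Math. 152 (2016) =
arXiv:1405.2593 [Maynard2016DenseClusters], proof of Proposition 9.4 p. 26: the factor
`∑_{r₀ < x^ξ, (r₀,W₀)=1} ỹ²_{r₀}/∏_{p ∣ r₀}(p + O(k))` of the diagonal sum.

For the weights on `ℤ` (P94-SPEC §1d′; `Maynard2016Prop94YPlusBound.sum_sq_yPlus_mul_prod_le`) the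
one-dimensional factor is `∑_{r₀ ∈ box₀(M,R₀)} φ(r₀)^{-2} H(r₀)² ∏_{p ∣ r₀}(p + 4k + 3)` with
`H(r₀) = ∏_{p ∣ r₀}(1 + 4k/p)`.  Writing each term as `φ(r₀)^{-1} ∏_{p ∣ r₀}(1 + g(p))` with
`1 + g(p) = (p+4k+3)(1+4k/p)²/(p-1) = 1 + O(k/p)` (all `p ∣ r₀` exceed `2k²` when every prime `∤ M`
does), `SelbergSieveOneDim.sum_inv_totient_mul_prod_le` and `∑_{p > 2k²} 8k²/p² ≤ 12 log 4`
(`FGKMT2018.sum_ite_div_sq_le`) give **`sum_oneDim_le`**: the sum is `≤ 4¹⁰⁸ · S₀(M, R₀)`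
(`S₀ = ∑_{r₀ ∈ box₀} 1/φ(r₀) = λ̃_1`; one factor `S₀` is later cancelled twice by the
normalisation `λ̃_1^{-2}` of the majorant, leaving the saving `S₀^{-1} ≪ (M/φ(M))/log R₀`).

## References
* J. Maynard, *Dense clusters of primes in subsets*, Compositio Math. 152 (2016), proof of Prop. 9.4
  p. 26 [Maynard2016DenseClusters].
-/

noncomputable section

open Finset

namespace Literature.NumberTheory.Sieve.FGKMT2018

variable {k : ℕ}

/-- `φ(n) = ∏_{p ∣ n}(p - 1)` in `ℝ` for squarefree `n`. [cite: Maynard2016DenseClusters, §8 p. 14 (multiplicativity conventions)] -/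
private theorem totient_cast_eq_prod {n : ℕ} (hn : Squarefree n) :
    ((Nat.totient n : ℕ) : ℝ) = ∏ p ∈ n.primeFactors, ((p : ℝ) - 1) := by
  have h := Nat.totient_mul_prod_primeFactors n
  rw [Nat.prod_primeFactors_of_squarefree hn, mul_comm] at h
  have h' : Nat.totient n = ∏ p ∈ n.primeFactors, (p - 1) := Nat.eq_of_mul_eq_mul_left
    (Nat.pos_of_ne_zero hn.ne_zero) h
  rw [h', Nat.cast_prod]
  refine Finset.prod_congr rfl fun p hp => ?_
  rw [Nat.cast_sub (Nat.prime_of_mem_primeFactors hp).one_lt.le, Nat.cast_one]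

/-! ### The local factor `(p + 4k + 3)(1 + 4k/p)²/(p - 1) = 1 + O(k/p)` -/

/-- Polynomial inequality behind the local factor: for `2k² < p` and `k ≥ 2`,
`(p + 4k + 3)(1 + 4k/p)² ≤ (p - 1) + (12k + 45)`.
[cite: Maynard2016DenseClusters, proof of Prop. 9.4 p. 26 («∏(1 + O(k)/p)»)] -/
theorem oneDim_numer_le (hk : 2 ≤ k) {p : ℕ} (hp : 2 * k ^ 2 < p) :
    ((p : ℝ) + 4 * ((k : ℝ) + 1) - 1) * (1 + 4 * (k : ℝ) / p) ^ 2 ≤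
      ((p : ℝ) - 1) + (12 * k + 45) := by
  have hX : (2 : ℝ) * (k : ℝ) ^ 2 + 1 ≤ p := by exact_mod_cast Nat.succ_le_of_lt hp
  have hK : (2 : ℝ) ≤ k := by exact_mod_cast hk
  have hK0 : (0 : ℝ) ≤ k := by positivity
  have hp0 : (0 : ℝ) < p := by nlinarith
  set X : ℝ := (p : ℝ) with hXdef
  set K : ℝ := (k : ℝ) with hKdef
  have h0 : 0 ≤ X - (2 * K ^ 2 + 1) := by linarith
  have hkey : (X + 4 * K + 3) * (X + 4 * K) ^ 2 ≤ (X + 12 * K + 44) * X ^ 2 := by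
    have h1 : 0 ≤ (X - (2 * K ^ 2 + 1)) * (X - (2 * K ^ 2 + 1)) := mul_nonneg h0 h0
    have h2 : 0 ≤ K * (116 * K - 24) * (X - (2 * K ^ 2 + 1)) :=
      mul_nonneg (mul_nonneg hK0 (by linarith)) h0
    have h3 : 0 ≤ K ^ 3 * (68 * K - 112) := mul_nonneg (by positivity) (by linarith)
    have h4 : 0 ≤ K * (68 * K - 24) := mul_nonneg hK0 (by linarith)
    nlinarith [h1, h2, h3, h4, h0]
  have hrw : (1 + 4 * K / X) = (X + 4 * K) / X := by
    field_simp
  rw [hrw, div_pow, ← mul_div_assoc, div_le_iff₀ (by positivity)]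
  nlinarith [hkey]

/-- The local factor is `≥ 1`: `(p - 1) ≤ (p + 4k + 3)(1 + 4k/p)²` (`p ≥ 2`).
[cite: Maynard2016DenseClusters, proof of Prop. 9.4 p. 26] -/
theorem oneDim_factor_sub_one_nonneg (k : ℕ) {p : ℕ} (hp : p.Prime) :
    0 ≤ ((p : ℝ) + 4 * ((k : ℝ) + 1) - 1) * (1 + 4 * (k : ℝ) / p) ^ 2 / ((p : ℝ) - 1) - 1 := by
  have hp2 : (2 : ℝ) ≤ p := by exact_mod_cast hp.two_le
  have hk0 : (0 : ℝ) ≤ k := Nat.cast_nonneg k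
  have hp1 : 0 < (p : ℝ) - 1 := by linarith
  rw [sub_nonneg, le_div_iff₀ hp1, one_mul]
  have h1 : (1 : ℝ) ≤ (1 + 4 * (k : ℝ) / p) ^ 2 := by
    have : (0 : ℝ) ≤ 4 * (k : ℝ) / p := by positivity
    nlinarith
  nlinarith [h1]

/-- **Per-prime estimate**: for `2k² < p`, `k ≥ 2`,
`g(p)/(p-1) ≤ 9 · 8k²/p²` where `1 + g(p) = (p+4k+3)(1+4k/p)²/(p-1)`.
[cite: Maynard2016DenseClusters, proof of Prop. 9.4 p. 26; proof of Prop. 9.1 p. 20] -/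
theorem oneDim_factor_div_le (hk : 2 ≤ k) {p : ℕ} (hp : 2 * k ^ 2 < p) :
    (((p : ℝ) + 4 * ((k : ℝ) + 1) - 1) * (1 + 4 * (k : ℝ) / p) ^ 2 / ((p : ℝ) - 1) - 1) /
        ((p : ℝ) - 1) ≤ 9 * (8 * (k : ℝ) ^ 2 / (p : ℝ) ^ 2) := by
  have hK : (2 : ℝ) ≤ k := by exact_mod_cast hk
  have hX : (2 : ℝ) * (k : ℝ) ^ 2 < p := by exact_mod_cast hp
  have hp8 : (8 : ℝ) < p := by nlinarith
  have hp1 : 0 < (p : ℝ) - 1 := by linarith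
  have hp0 : (0 : ℝ) < p := by linarith
  have hnum := oneDim_numer_le hk hp
  -- `g(p) ≤ (12k+45)/(p-1)`
  have hg : ((p : ℝ) + 4 * ((k : ℝ) + 1) - 1) * (1 + 4 * (k : ℝ) / p) ^ 2 / ((p : ℝ) - 1) - 1 ≤
      (12 * k + 45) / ((p : ℝ) - 1) := by
    rw [div_sub_one hp1.ne', div_le_div_iff_of_pos_right hp1]
    linarith
  calc _ ≤ (12 * (k : ℝ) + 45) / ((p : ℝ) - 1) / ((p : ℝ) - 1) :=
        div_le_div_of_nonneg_right hg hp1.le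
    _ = (12 * (k : ℝ) + 45) / ((p : ℝ) - 1) ^ 2 := by rw [div_div, sq]
    _ ≤ 9 * (8 * (k : ℝ) ^ 2 / (p : ℝ) ^ 2) := by
        rw [div_le_iff₀ (by positivity)]
        have h4 : (p : ℝ) ^ 2 / 4 ≤ ((p : ℝ) - 1) ^ 2 := by nlinarith
        have h5 : 12 * (k : ℝ) + 45 ≤ 18 * (k : ℝ) ^ 2 := by nlinarith
        calc 12 * (k : ℝ) + 45 ≤ 18 * (k : ℝ) ^ 2 := h5
          _ = 9 * (8 * (k : ℝ) ^ 2 / (p : ℝ) ^ 2) * ((p : ℝ) ^ 2 / 4) := by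
              field_simp
              ring
          _ ≤ 9 * (8 * (k : ℝ) ^ 2 / (p : ℝ) ^ 2) * ((p : ℝ) - 1) ^ 2 :=
              mul_le_mul_of_nonneg_left h4 (by positivity)

/-! ### The one-dimensional diagonal sum -/

/-- **`∑_{r₀ ∈ box₀(M,R₀)} φ(r₀)^{-2} H(r₀)² ∏_{p ∣ r₀}(p + 4k + 3) ≤ 4¹⁰⁸ S₀(M,R₀)`** when every prime
not dividing `M` exceeds `2k²` (`k ≥ 2`), where `H(r₀) = ∏_{p ∣ r₀}(1 + 4k/p)` and
`S₀ = ∑_{r₀ ∈ box₀} 1/φ(r₀)`: the one-dimensional factor of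
`Maynard2016Prop94YPlusBound.sum_sq_yPlus_mul_prod_le`.
[cite: Maynard2016DenseClusters, proof of Prop. 9.4 p. 26 («∑_{r₀} ỹ²_{r₀}/∏(p+O(k)) … ∏_{p ∤ W₀}(1 + O(k)/p²) = O(1)»)] -/
theorem sum_oneDim_le (hk : 2 ≤ k) {M : ℕ} (hM : ∀ p : ℕ, p.Prime → ¬ p ∣ M → 2 * k ^ 2 < p)
    (R₀ : ℝ) :
    ∑ r₀ ∈ SelbergBox.box₀ M R₀,
        (((Nat.totient r₀ : ℕ) : ℝ)⁻¹) ^ 2 * (∏ p ∈ r₀.primeFactors, (1 + 4 * (k : ℝ) / p)) ^ 2 *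
          ∏ p ∈ r₀.primeFactors, ((p : ℝ) + 4 * ((k : ℝ) + 1) - 1) ≤
      (4 : ℝ) ^ 108 * SelbergBox.S0 M R₀ := by
  classical
  set g : ℕ → ℝ := fun p => if p.Prime ∧ ¬ p ∣ M then
    ((p : ℝ) + 4 * ((k : ℝ) + 1) - 1) * (1 + 4 * (k : ℝ) / p) ^ 2 / ((p : ℝ) - 1) - 1 else 0 with hgdef
  have hg : ∀ p, 0 ≤ g p := by
    intro p
    simp only [hgdef]
    split_ifs with h
    · exact oneDim_factor_sub_one_nonneg k h.1
    · exact le_rfl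
  -- each term is `φ(r₀)⁻¹ ∏_{p ∣ r₀}(1 + g p)`
  have hterm : ∀ r₀ ∈ SelbergBox.box₀ M R₀,
      (((Nat.totient r₀ : ℕ) : ℝ)⁻¹) ^ 2 * (∏ p ∈ r₀.primeFactors, (1 + 4 * (k : ℝ) / p)) ^ 2 *
          ∏ p ∈ r₀.primeFactors, ((p : ℝ) + 4 * ((k : ℝ) + 1) - 1) =
        ((Nat.totient r₀ : ℕ) : ℝ)⁻¹ * ∏ p ∈ r₀.primeFactors, (1 + g p) := by
    intro r₀ hr₀
    obtain ⟨-, hsq, hcop⟩ := SelbergBox.mem_box₀.1 hr₀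
    have hfac : ∀ p ∈ r₀.primeFactors, 1 + g p =
        ((p : ℝ) + 4 * ((k : ℝ) + 1) - 1) * (1 + 4 * (k : ℝ) / p) ^ 2 / ((p : ℝ) - 1) := by
      intro p hp
      have hpP : p.Prime := Nat.prime_of_mem_primeFactors hp
      have hpM : ¬ p ∣ M := (Nat.Prime.coprime_iff_not_dvd hpP).1
        (Nat.Coprime.coprime_dvd_left (Nat.dvd_of_mem_primeFactors hp) hcop)
      simp only [hgdef, if_pos (And.intro hpP hpM)]
      ring
    have hP1 : ∀ p ∈ r₀.primeFactors, (0 : ℝ) < (p : ℝ) - 1 := fun p hp => by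
      have : (2 : ℝ) ≤ p := by exact_mod_cast (Nat.prime_of_mem_primeFactors hp).two_le
      linarith
    have hP0 : (∏ p ∈ r₀.primeFactors, ((p : ℝ) - 1)) ≠ 0 :=
      Finset.prod_ne_zero_iff.2 fun p hp => (hP1 p hp).ne'
    rw [Finset.prod_congr rfl hfac, Finset.prod_div_distrib, Finset.prod_mul_distrib,
      Finset.prod_pow, totient_cast_eq_prod hsq]
    field_simp
  rw [Finset.sum_congr rfl hterm]
  refine (SelbergBox.sum_inv_totient_mul_prod_le M R₀ hg).trans ?_
  -- the Euler-type product is `≤ 4¹⁰⁸`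
  set P := (Finset.range (⌊R₀⌋₊ + 1)).filter Nat.Prime with hP
  have hPeq : P = Nat.primesBelow (⌊R₀⌋₊ + 1) := rfl
  have hPp : ∀ p ∈ P, p.Prime := fun p hp => (Finset.mem_filter.1 hp).2
  have hdiv : ∀ p ∈ P, g p / ((p : ℝ) - 1) ≤
      9 * (if 2 * k ^ 2 < p then 8 * (k : ℝ) ^ 2 / (p : ℝ) ^ 2 else 0) := by
    intro p hp
    have hpP := hPp p hp
    by_cases hpM : p ∣ M
    · have : g p = 0 := by simp only [hgdef, if_neg (fun h : p.Prime ∧ ¬ p ∣ M => h.2 hpM)]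
      rw [this, zero_div]
      split_ifs
      · positivity
      · simp
    · have h2 : 2 * k ^ 2 < p := hM p hpP hpM
      simp only [hgdef, if_pos (And.intro hpP hpM), if_pos h2]
      exact oneDim_factor_div_le hk h2
  have hdiv0 : ∀ p ∈ P, 0 ≤ g p / ((p : ℝ) - 1) := fun p hp => by
    have : (2 : ℝ) ≤ p := by exact_mod_cast (hPp p hp).two_le
    exact div_nonneg (hg p) (by linarith)
  have hprod : ∏ p ∈ P, (1 + g p / ((p : ℝ) - 1)) ≤ (4 : ℝ) ^ 108 := by
    calc ∏ p ∈ P, (1 + g p / ((p : ℝ) - 1))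
        ≤ Real.exp (∑ p ∈ P, g p / ((p : ℝ) - 1)) := by
          rw [Real.exp_sum]
          refine Finset.prod_le_prod (fun p hp => by linarith [hdiv0 p hp]) fun p _ => ?_
          linarith [Real.add_one_le_exp (g p / ((p : ℝ) - 1))]
      _ ≤ Real.exp (9 * ∑ p ∈ Nat.primesBelow (⌊R₀⌋₊ + 1),
            (if 2 * k ^ 2 < p then 8 * (k : ℝ) ^ 2 / (p : ℝ) ^ 2 else 0)) := by
          refine Real.exp_le_exp.2 ?_
          rw [Finset.mul_sum, ← hPeq]
          exact Finset.sum_le_sum hdiv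
      _ ≤ Real.exp (9 * (12 * Real.log 4)) := Real.exp_le_exp.2
          (mul_le_mul_of_nonneg_left (sum_ite_div_sq_le hk _) (by norm_num))
      _ = (4 : ℝ) ^ 108 := by
          rw [show (9 : ℝ) * (12 * Real.log 4) = Real.log ((4 : ℝ) ^ 108) by
            rw [Real.log_pow]; push_cast; ring, Real.exp_log (by positivity)]
  calc SelbergBox.S0 M R₀ * ∏ p ∈ P, (1 + g p / ((p : ℝ) - 1))
      ≤ SelbergBox.S0 M R₀ * (4 : ℝ) ^ 108 :=
        mul_le_mul_of_nonneg_left hprod SelbergBox.S0_nonneg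
    _ = (4 : ℝ) ^ 108 * SelbergBox.S0 M R₀ := mul_comm _ _

end Literature.NumberTheory.Sieve.FGKMT2018
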